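import Mathlib
import Literature.Algebra.Polynomial.FischerInnerProduct
import Summits.NavierStokesRegularity.NavierStokesRegularity.Theorems.ThreadingFluxCentreJetDefs
import Summits.NavierStokesRegularity.NavierStokesRegularity.Theorems.ThreadingFluxCentreJetPolyToolkit
import HarnessLib

/-!
# Crux `PoloidalLiouville` (stmt-NavierStokesRegularity-1222, wall W1), crux idea «steady-centre-sieve» (ns-idea-15 g5):
# A2 `NoHarmonicPolhodeInvariant` — no harmonic polhode invariant beyond degree 2

`theorem CentreJet.noHarmonicPolhodeInvariant : NoHarmonicPolhodeInvariant` (Defs twin, body = CentreJetSketch l.292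
verbatim): for pairwise distinct `aᵢ` with `Σ aᵢ = 0`, if `F(|y|², ⟪y,Sy⟫)` is harmonic then `F = C c₀ + C c₁ * X 1`.

Proof (the card's `(ρ, s, q)` computation, RESULTS §5c, kernel form):
* chain rule through the substitution `A = aeval ![rhoPoly, strainPoly a]`:
  `Δ(A F) = A(6F₀ + 4v₀F₀₀ + 8v₁F₀₁) + 2(Σaᵢ)·A F₁ + 4q·A F₁₁`, `q = Σ aᵢ² yᵢ²`
  (`∇ρ·∇ρ = 4ρ`, `∇ρ·∇s = 4s`, `∇s·∇s = 4q`, `Δρ = 6`, `Δs = 2Σaᵢ`);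
* independence of `q` from `ℝ[ρ, s]` WITHOUT inverting the Vandermonde matrix: in the squared variables
  `Σaᵢ²uᵢ = (a₀−a₁)(a₀−a₂)·u₀ − a₁a₂·Σuᵢ + (a₁+a₂)·Σaᵢuᵢ`, i.e. `q̂ = ψ(αv₀ + βv₁ + γv₂)` with `α ≠ 0` for the
  toolkit chart `ψ`; so `A G + 4q·A K = 0` pulls back (injectivity of `expand 2` and of `ψ`) to
  `G̃ + 4(αv₀+βv₁+γv₂)K̃ = 0` on `ℝ[v]` with `G̃, K̃ ∈ ℝ[v₁,v₂]`, and `∂_{v₀}` gives `4α K̃ = 0`: `K = 0`, then `G = 0`;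
* the two linear PDEs `F₁₁ = 0`, `6F₀ + 4v₀F₀₀ + 8v₁F₀₁ = 0` are diagonal on monomials
  (number operators `xᵢ∂ᵢ`, `xᵢ²∂ᵢ²`; the coefficient formulas are those of `Literature.Algebra.Polynomial.coeff_X_mul_pderiv`,
  `coeff_X_mul_X_mul_pderiv_pderiv` in `FischerNumberOperator.lean`, recomputed inside the proof because that module was not
  buildable on the Lean farm at landing time): `m₁(m₁−1)·c_m = 0` and
  `m₀(4m₀ + 8m₁ + 2)·c_m = 0`, so only the monomials `1` and `v₁` survive.

Information-grade algebra about one crux idea's typed objects (`--supports 1222`); `PoloidalLiouville` (1222) OPEN;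
NS regularity NOT proved.  ns-wall-eng-5 g5 (cell ns-wall-extremal), 0 kit.
-/

-- the summit and its single sub-problem share the name (CONVENTIONS §1)
set_option linter.dupNamespace false

noncomputable section

namespace Summit.NavierStokesRegularity.NavierStokesRegularity.Theorems.PoloidalLiouville.CentreJet

open MvPolynomial EulerTop
open Literature.Algebra.Polynomial (pderiv_pderiv_comm)

section ChainRule

variable (a : Fin 3 → ℝ)

/-- `q = Σ aᵢ² yᵢ²` (`= |Sy|²`). -/
def qPoly : MvPolynomial (Fin 3) ℝ := ∑ i : Fin 3, C (a i ^ 2) * X i ^ 2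

/-- The substitution sends `v₀ ↦ |y|²`. -/
@[simp] theorem aeval_pair_X0 : aeval ![rhoPoly, strainPoly a] (X 0 : MvPolynomial (Fin 2) ℝ) = rhoPoly := by simp
/-- The substitution sends `v₁ ↦ ⟪y,Sy⟫`. -/
@[simp] theorem aeval_pair_X1 : aeval ![rhoPoly, strainPoly a] (X 1 : MvPolynomial (Fin 2) ℝ) = strainPoly a := by
  simp
/-- The substitution fixes constants. -/
@[simp] theorem aeval_pair_C (r : ℝ) : aeval ![rhoPoly, strainPoly a] (C r : MvPolynomial (Fin 2) ℝ) = C r := by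
  simp

/-- `∂ᵢ yⱼ² = 2 yᵢ δᵢⱼ`. -/
theorem pderiv_X_sq (i j : Fin 3) :
    pderiv i (X j ^ 2 : MvPolynomial (Fin 3) ℝ) = if j = i then C 2 * X i else 0 := by
  rw [sq, Derivation.leibniz, pderiv_X, smul_eq_mul, Pi.single_apply]
  split_ifs with h
  · subst h
    rw [map_ofNat]
    ring
  · rw [mul_zero, zero_add]

/-- `∂ᵢ |y|² = 2 yᵢ`. -/
theorem pderiv_rhoPoly (i : Fin 3) : pderiv i rhoPoly = C 2 * X i := by
  simp only [rhoPoly, map_sum, pderiv_X_sq, Finset.sum_ite_eq', Finset.mem_univ, if_true]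

/-- `∂ᵢ ⟪y,Sy⟫ = 2 aᵢ yᵢ`. -/
theorem pderiv_strainPoly (i : Fin 3) : pderiv i (strainPoly a) = C 2 * C (a i) * X i := by
  simp only [strainPoly, map_sum, pderiv_C_mul, pderiv_X_sq, mul_ite, mul_zero, Finset.sum_ite_eq',
    Finset.mem_univ, if_true]
  ring

/-- First-order chain rule through `(|y|², ⟪y,Sy⟫)`: `∂ᵢ F(ρ,s) = 2yᵢ (F₀ + aᵢ F₁)(ρ,s)`. -/
theorem pderiv_aeval_pair (F : MvPolynomial (Fin 2) ℝ) (i : Fin 3) :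
    pderiv i (aeval ![rhoPoly, strainPoly a] F) =
      C 2 * X i * (aeval ![rhoPoly, strainPoly a] (pderiv 0 F) +
        C (a i) * aeval ![rhoPoly, strainPoly a] (pderiv 1 F)) := by
  induction F using MvPolynomial.induction_on with
  | C r => simp
  | add p q hp hq =>
    simp only [map_add, hp, hq]
    ring
  | mul_X p n hp =>
    fin_cases n
    · simp only [Fin.zero_eta, map_mul, map_add, aeval_pair_X0, pderiv_mul, hp, pderiv_rhoPoly, pderiv_X_self,
        pderiv_X_of_ne (show (0 : Fin 2) ≠ 1 by decide), mul_one, mul_zero, add_zero]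
      ring
    · simp only [Fin.mk_one, map_mul, map_add, aeval_pair_X1, pderiv_mul, hp, pderiv_strainPoly, pderiv_X_self,
        pderiv_X_of_ne (show (1 : Fin 2) ≠ 0 by decide), mul_one, mul_zero, add_zero]
      ring

/-- Second-order chain rule: the Laplacian of `F(|y|², ⟪y,Sy⟫)`. -/
theorem laplacian_aeval_pair (F : MvPolynomial (Fin 2) ℝ) :
    ∑ i : Fin 3, pderiv i (pderiv i (aeval ![rhoPoly, strainPoly a] F)) =
      aeval ![rhoPoly, strainPoly a]
          (C 6 * pderiv 0 F + C 4 * X 0 * pderiv 0 (pderiv 0 F) + C 8 * X 1 * pderiv 0 (pderiv 1 F)) +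
        C (2 * ∑ i : Fin 3, a i) * aeval ![rhoPoly, strainPoly a] (pderiv 1 F) +
        C 4 * qPoly a * aeval ![rhoPoly, strainPoly a] (pderiv 1 (pderiv 1 F)) := by
  simp only [pderiv_aeval_pair, pderiv_mul, pderiv_C, pderiv_X_self, map_add, zero_mul, zero_add]
  rw [pderiv_pderiv_comm 1 0 F]
  simp only [Fin.sum_univ_three, map_add, map_mul, aeval_pair_X0, aeval_pair_X1, map_ofNat]
  simp only [rhoPoly, strainPoly, qPoly, Fin.sum_univ_three, map_pow]
  ring

end ChainRule

/-! ### Independence of `q` from `ℝ[|y|², ⟪y,Sy⟫]` (Vandermonde, inverse-free) -/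

section Independence

variable {a : Fin 3 → ℝ}

/-- `(|y|², ⟪y,Sy⟫) = expand 2 ∘ (ℓ₁, ℓ₂)`: the substitution factors through the squared variables. -/
theorem expand_comp_aeval_ell (a : Fin 3 → ℝ) :
    (expand 2).comp (aeval ![ell1, ell2 a]) = aeval ![rhoPoly, strainPoly a] := by
  refine algHom_ext fun i => ?_
  fin_cases i
  · simp [ell1, rhoPoly, map_sum]
  · simp [ell2, strainPoly, map_sum]

/-- `q = Σ aᵢ² yᵢ²` is `expand 2` of the linear form `q̂ = Σ aᵢ² uᵢ`. -/
theorem expand_qHat (a : Fin 3 → ℝ) : expand 2 (∑ i : Fin 3, C (a i ^ 2) * X i) = qPoly a := by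
  simp [qPoly, map_sum]

/-- `Σ aᵢ² uᵢ = (a₀−a₁)(a₀−a₂) u₀ − a₁a₂ Σuᵢ + (a₁+a₂) Σaᵢuᵢ`, i.e. `q̂` read through the chart `ψ`. -/
theorem qHat_eq_psiHom (a : Fin 3 → ℝ) : (∑ i : Fin 3, C (a i ^ 2) * X i : MvPolynomial (Fin 3) ℝ) =
    psiHom a (C ((a 0 - a 1) * (a 0 - a 2)) * X 0 + C (-(a 1 * a 2)) * X 1 + C (a 1 + a 2) * X 2) := by
  simp only [map_add, map_mul, psiHom_C, psiHom_X0, psiHom_X1, psiHom_X2, ell1, ell2, Fin.sum_univ_three, map_sub,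
    map_neg, map_pow]
  ring

/-- `∂₀ (α v₀ + β v₁ + γ v₂) = α`. -/
theorem pderiv_zero_lin (α β γ : ℝ) :
    pderiv 0 (C α * X 0 + C β * X 1 + C γ * X 2 : MvPolynomial (Fin 3) ℝ) = C α := by
  simp [pderiv_X]

/-- If `A G + 4 q · A K = 0` with `A = aeval ![rhoPoly, strainPoly a]` then `K = 0` and `G = 0`. -/
theorem independence (ha : Function.Injective a) {G K : MvPolynomial (Fin 2) ℝ}
    (h : aeval ![rhoPoly, strainPoly a] G + C 4 * qPoly a * aeval ![rhoPoly, strainPoly a] K = 0) :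
    K = 0 ∧ G = 0 := by
  have h21 := ne21_of_injective ha
  have hα : (4 * ((a 0 - a 1) * (a 0 - a 2))) ≠ 0 := by
    refine mul_ne_zero (by norm_num) (mul_ne_zero (sub_ne_zero.mpr ?_) (sub_ne_zero.mpr ?_))
    · exact fun h => absurd (ha h) (by decide)
    · exact fun h => absurd (ha h) (by decide)
  set lin : MvPolynomial (Fin 3) ℝ :=
    C ((a 0 - a 1) * (a 0 - a 2)) * X 0 + C (-(a 1 * a 2)) * X 1 + C (a 1 + a 2) * X 2 with hlin
  -- pull back through `expand 2`
  have hA : ∀ P, aeval ![rhoPoly, strainPoly a] P = expand 2 (aeval ![ell1, ell2 a] P) := fun P => by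
    rw [← AlgHom.comp_apply, expand_comp_aeval_ell]
  have h1 : expand 2 (aeval ![ell1, ell2 a] G + C 4 * (∑ i : Fin 3, C (a i ^ 2) * X i) *
      aeval ![ell1, ell2 a] K) = 0 := by
    rw [map_add, map_mul, map_mul, expand_C, expand_qHat, ← hA, ← hA]
    exact h
  have h2 := (expand_eq_zero two_pos).mp h1
  -- pull back through `ψ`
  have hB : ∀ P, aeval ![ell1, ell2 a] P = psiHom a (rename Fin.succ P) := fun P => by
    rw [← AlgHom.comp_apply, psiHom_comp_rename_succ]
  rw [hB, hB, qHat_eq_psiHom, ← hlin] at h2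
  have h3 : psiHom a (rename Fin.succ G + C 4 * lin * rename Fin.succ K) = 0 := by
    rw [map_add, map_mul, map_mul, psiHom_C]
    exact h2
  have h4 : rename Fin.succ G + C 4 * lin * rename Fin.succ K = 0 :=
    (psi h21).injective (by rw [psi_apply, h3, map_zero])
  -- differentiate in `v₀`
  have h5 := congrArg (pderiv 0) h4
  rw [map_add, pderiv_zero_rename_succ, pderiv_mul, pderiv_zero_rename_succ, pderiv_C_mul, hlin, pderiv_zero_lin,
    map_zero, mul_zero, add_zero, zero_add, ← map_mul] at h5
  have hK' : rename Fin.succ K = (0 : MvPolynomial (Fin 3) ℝ) := by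
    rcases mul_eq_zero.mp h5 with hc | hc
    · exact absurd (C_eq_zero.mp hc) hα
    · exact hc
  have hK : K = 0 := rename_injective _ (Fin.succ_injective 2) (hK'.trans (map_zero _).symm)
  refine ⟨hK, ?_⟩
  rw [hK', mul_zero, add_zero] at h4
  exact rename_injective _ (Fin.succ_injective 2) (h4.trans (map_zero _).symm)

end Independence

/-! ### The two diagonal linear PDEs on `ℝ[v₀, v₁]` -/

/-- If `F₁₁ = 0` and `6F₀ + 4v₀F₀₀ + 8v₁F₀₁ = 0` then `F = c₀ + c₁ v₁`. -/
theorem eq_C_add_C_mul_X_of_pdes (F : MvPolynomial (Fin 2) ℝ) (hK : pderiv 1 (pderiv 1 F) = 0)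
    (hG : C 6 * pderiv 0 F + C 4 * X 0 * pderiv 0 (pderiv 0 F) + C 8 * X 1 * pderiv 0 (pderiv 1 F) = 0) :
    ∃ c₀ c₁ : ℝ, F = C c₀ + C c₁ * X 1 := by
  classical
  -- number-operator coefficients `(xᵢ ∂ᵢ q)_α = αᵢ q_α`, `(xᵢ² ∂ᵢ² q)_α = αᵢ(αᵢ − 1) q_α`
  -- (the formulas of `Literature.Algebra.Polynomial.coeff_X_mul_pderiv` / `coeff_X_mul_X_mul_pderiv_pderiv`)
  have hN : ∀ (i : Fin 2) (q : MvPolynomial (Fin 2) ℝ) (α : Fin 2 →₀ ℕ),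
      coeff α (X i * pderiv i q) = (α i : ℝ) * coeff α q := by
    intro i q α
    rw [coeff_X_mul']
    by_cases h : i ∈ α.support
    · rw [if_pos h, coeff_pderiv]
      have hi : α i ≠ 0 := Finsupp.mem_support_iff.1 h
      rw [Finsupp.sub_add_single_one_cancel hi, Finsupp.tsub_apply, Finsupp.single_eq_same]
      have : 1 ≤ α i := Nat.one_le_iff_ne_zero.2 hi
      push_cast [Nat.cast_sub this]
      ring
    · rw [if_neg h]
      have hi : α i = 0 := by simpa [Finsupp.mem_support_iff] using h
      rw [hi, Nat.cast_zero, zero_mul]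
  have hN2 : ∀ (i : Fin 2) (q : MvPolynomial (Fin 2) ℝ) (α : Fin 2 →₀ ℕ),
      coeff α (X i * (X i * pderiv i (pderiv i q))) = (α i : ℝ) * ((α i : ℝ) - 1) * coeff α q := by
    intro i q α
    rw [coeff_X_mul']
    by_cases h : i ∈ α.support
    · rw [if_pos h, hN, coeff_pderiv]
      have hi : α i ≠ 0 := Finsupp.mem_support_iff.1 h
      rw [Finsupp.sub_add_single_one_cancel hi, Finsupp.tsub_apply, Finsupp.single_eq_same]
      have : 1 ≤ α i := Nat.one_le_iff_ne_zero.2 hi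
      push_cast [Nat.cast_sub this]
      ring
    · rw [if_neg h]
      have hi : α i = 0 := by simpa [Finsupp.mem_support_iff] using h
      rw [hi, Nat.cast_zero, zero_mul, zero_mul]
  -- (i) no monomial involves `v₀`
  have h0 : ∀ m : Fin 2 →₀ ℕ, m 0 ≠ 0 → coeff m F = 0 := by
    intro m hm
    have hid : X 0 * (C 6 * pderiv 0 F + C 4 * X 0 * pderiv 0 (pderiv 0 F) + C 8 * X 1 * pderiv 0 (pderiv 1 F)) =
        C 6 * (X 0 * pderiv 0 F) + C 4 * (X 0 * (X 0 * pderiv 0 (pderiv 0 F))) +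
          C 8 * (X 1 * pderiv 1 (X 0 * pderiv 0 F)) := by
      rw [pderiv_mul, pderiv_X_of_ne (show (0 : Fin 2) ≠ 1 by decide), zero_mul, zero_add,
        pderiv_pderiv_comm 1 0 F]
      ring
    have h := congrArg (coeff m) hid
    rw [hG, mul_zero, coeff_zero] at h
    simp only [coeff_add, coeff_C_mul, hN, hN2] at h
    have hm1 : (1 : ℝ) ≤ m 0 := by exact_mod_cast Nat.one_le_iff_ne_zero.mpr hm
    have hm2 : (0 : ℝ) ≤ m 1 := Nat.cast_nonneg _
    have hpos : (0 : ℝ) < 6 * (m 0 : ℝ) + 4 * (m 0 : ℝ) * ((m 0 : ℝ) - 1) + 8 * (m 1 : ℝ) * (m 0 : ℝ) := by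
      nlinarith
    have hc : coeff m F * (6 * (m 0 : ℝ) + 4 * (m 0 : ℝ) * ((m 0 : ℝ) - 1) + 8 * (m 1 : ℝ) * (m 0 : ℝ)) = 0 := by
      linear_combination -h
    exact (mul_eq_zero.mp hc).resolve_right hpos.ne'
  -- (ii) degree in `v₁` at most one
  have h1 : ∀ m : Fin 2 →₀ ℕ, 2 ≤ m 1 → coeff m F = 0 := by
    intro m hm
    have h := congrArg (coeff m) (show X 1 * (X 1 * pderiv 1 (pderiv 1 F)) = 0 by rw [hK, mul_zero, mul_zero])
    rw [hN2, coeff_zero] at h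
    have hm2 : (2 : ℝ) ≤ m 1 := by exact_mod_cast hm
    have hpos : (0 : ℝ) < (m 1 : ℝ) * ((m 1 : ℝ) - 1) := by nlinarith
    exact (mul_eq_zero.mp h).resolve_left hpos.ne'
  -- (iii) only `1` and `v₁` survive
  refine ⟨coeff 0 F, coeff (Finsupp.single 1 1) F, ?_⟩
  ext m
  rw [coeff_add, coeff_C, coeff_C_mul, coeff_X]
  by_cases hm0 : m 0 = 0
  · by_cases hm1 : m 1 = 0
    · have hm : m = 0 := by
        ext j; fin_cases j
        · simpa using hm0
        · simpa using hm1
      subst hm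
      rw [if_pos rfl, if_neg (fun h => one_ne_zero (Finsupp.single_eq_zero.mp h))]
      ring
    · by_cases hm1' : m 1 = 1
      · have hm : m = Finsupp.single 1 1 := by
          ext j; fin_cases j
          · simpa using hm0
          · simpa using hm1'
        subst hm
        rw [if_neg (fun h => one_ne_zero (Finsupp.single_eq_zero.mp h.symm)), if_pos rfl]
        ring
      · have hge : 2 ≤ m 1 := by omega
        have hne0 : (0 : Fin 2 →₀ ℕ) ≠ m := fun h => hm1 (by rw [← h]; rfl)
        have hne1 : Finsupp.single (1 : Fin 2) 1 ≠ m := fun h => hm1' (by rw [← h]; simp)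
        rw [h1 m hge, if_neg hne0, if_neg hne1]
        ring
  · have hne0 : (0 : Fin 2 →₀ ℕ) ≠ m := fun h => hm0 (by rw [← h]; rfl)
    have hne1 : Finsupp.single (1 : Fin 2) 1 ≠ m := fun h => hm0 (by rw [← h]; simp)
    rw [h0 m hm0, if_neg hne0, if_neg hne1]
    ring

/-! ### A2 by name -/

/-- **A2 (ns-idea-15 «steady-centre-sieve», CentreJetSketch l.292): for pairwise distinct `aᵢ` with `Σ aᵢ = 0`,
a harmonic polynomial in `|y|²` and `⟪y,Sy⟫` is affine in `⟪y,Sy⟫`.**  Kernel theorem BY NAME over the Theorems-side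
twin `NoHarmonicPolhodeInvariant` (body verbatim). -/
theorem noHarmonicPolhodeInvariant : NoHarmonicPolhodeInvariant := by
  intro a ha hsum F hΔ
  rw [laplacian_aeval_pair, hsum, mul_zero, C_0, zero_mul, add_zero] at hΔ
  obtain ⟨hK, hG⟩ := independence ha hΔ
  exact eq_C_add_C_mul_X_of_pdes F hK hG

end Summit.NavierStokesRegularity.NavierStokesRegularity.Theorems.PoloidalLiouville.CentreJet

end
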